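import Literature.AnabelianGeometry.SemiGraphs.PSCGraphicitySub
import Literature.AnabelianGeometry.SemiGraphs.PSCProofs
import Literature.AnabelianGeometry.SemiGraphs.PSCVerticialRamificationTransportProofs
import Literature.AnabelianGeometry.SemiGraphs.PSCCoveringDatumSturdy
import Literature.AnabelianGeometry.SemiGraphs.ProSigmaSubquotients
import Literature.AnabelianGeometry.SemiGraphs.ProSigmaCompletionHomCountExt
import HarnessLib

/-!
# [CombGC] Theorem 1.6 (ii): "graphically filtration-preserving ⟹ numerically cuspidal" from the rank statements

Mochizuki, *A combinatorial version of the Grothendieck conjecture*, Tohoku Math. J. **59** (2007)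
[CombGC], proof of Theorem 1.6 (ii), author's manuscript p. 14: "Now we verify sufficiency … by
Proposition 1.3 [Remark 1.3.1: for sturdy `G`, the ranks of `M^edge_G/M^cusp_G`, `M_G/M^vert_G`
coincide; `rank M^cusp_G = r(G) − 1` if `G` has cusps; `G` is noncuspidal iff `M^cusp_{G'} = 0` for all
finite étale `G' → G` — "thus one may compute `r(G)` as soon as one knows the difference between the
ranks of `M^edge_{G'}`, `M_{G'}/M^vert_{G'}`", p. 10] … `α` is numerically cuspidal."  Sub-DAG row
CombGC:Thm1.6(ii)/T16-L08 of the abc-iut cell (plan/L3/SUBDAG-CombGC-Thm16.md), KERNEL: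

* `isNumericallyCuspidal_of_isGraphicallyFiltrationPreserving_of_rankStatements`: for profinite
  `Π_G`, `Π_H`, STURDY `G`, `H` (the reduction to the sturdy case is row T16-L06/L07), the three
  Remark-1.3.1 statements `DualityRankEq`, `CuspRank`, `NoncuspidalIffCuspFilTrivial` of
  `PSCGraphicitySub.lean` for `G` and for `H` (hypotheses BY NAME; sub-node statements, not FACT-LIST
  facts), a prime `l ∈ Σ_G ∩ Σ_H`, and `α` graphically filtration-preserving ⟹ `α` numerically cuspidal.

Route (the printed recipe, with ranks read off as numbers of continuous homomorphisms to `ℤ/l`,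
`ProSigmaCompletionHomCount.lean`): `α` transports `U/vertFil U`, `edgeFil U / cl[U,U]` to the
corresponding subquotients for `H` at `α(U)` (`natCard_continuousMonoidHom_subquotient_congr`);
additivity of ranks along `0 → M^cusp → M^edge → M^edge/M^cusp → 0` (Rmk. 1.1.4, tree
`natCard_continuousMonoidHom_subquotient_eq_mul`) and the duality rank equality give
`#Hom(M^cusp_{G_U}, ℤ/l) = #Hom(M^cusp_{H_{α U}}, ℤ/l)`; the cusp rank (`= l^{r−1}` when `r > 0`) and the
noncuspidality criterion finish.  No new definitions or Prop facts; nothing here takes a side on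
[IUTchIII] Cor. 3.12. [cite: MochizukiCombGC2007, Thm 1.6(ii) p.14]
-/

namespace Literature.AnabelianGeometry.SemiGraphs

namespace PSCDatum

open SemiGraphOfAnabelioids (IsProSigmaCompletion)
open SemiGraphOfAnabelioids.IsProSigmaCompletion
open Literature.AnabelianGeometry.Anabelioids (IsSigmaInteger)

universe u

variable {P : Type u} [Group P] [TopologicalSpace P] [IsTopologicalGroup P]
variable {P' : Type u} [Group P'] [TopologicalSpace P'] [IsTopologicalGroup P']

/-! ### Pro-`Σ` in index form; closedness and nesting of the filtration -/

/-- `cl[U,U] ≤ M^cusp`-preimage: `(⁅U,U⁆).topologicalClosure ≤ cuspFil U`.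
[cite: MochizukiCombGC2007, Def 1.1(ii) p.7] -/
theorem closure_commutator_le_cuspFil (G : PSCDatum P) (U : Subgroup P) :
    (⁅U, U⁆).topologicalClosure ≤ G.cuspFil U :=
  Subgroup.topologicalClosure_minimal _ (G.commutator_le_cuspFil U)
    (Subgroup.isClosed_topologicalClosure _)

/-- `⁅edgeFil U, edgeFil U⁆ ≤ cl[U, U]` for closed `U` (as `edgeFil U ≤ U`).
[cite: MochizukiCombGC2007, Def 1.1(ii) p.7] -/
theorem commutator_edgeFil_le (G : PSCDatum P) {U : Subgroup P} (hU : IsClosed (U : Set P)) :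
    ⁅G.edgeFil U, G.edgeFil U⁆ ≤ (⁅U, U⁆).topologicalClosure :=
  (Subgroup.commutator_mono (G.edgeFil_le hU) (G.edgeFil_le hU)).trans
    (Subgroup.le_topologicalClosure _)

/-! ### Transport of subquotients along `α : Π_G ≅ Π_H` -/

/-- An isomorphism of topological groups carries `cl[U,U]` to `cl[α U, α U]`. [folklore] -/
private theorem map_closure_commutator (α : P ≃ₜ* P') (U : Subgroup P) :
    ((⁅U, U⁆).topologicalClosure).map α.toMulEquiv.toMonoidHom =
      (⁅U.map α.toMulEquiv.toMonoidHom, U.map α.toMulEquiv.toMonoidHom⁆).topologicalClosure := by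
  rw [← Subgroup.map_commutator]
  apply SetLike.coe_injective
  rw [Subgroup.coe_map, Subgroup.topologicalClosure_coe, Subgroup.topologicalClosure_coe,
    Subgroup.coe_map]
  exact α.toHomeomorph.image_closure _

omit [IsTopologicalGroup P] in
/-- **Transport of a subquotient along `α`.**  For closed subgroups `A`, `B` of the compact group `Π_G`
and `α : Π_G ≅ Π_H` with `α(A) = A'`, `α(B) = B'`, the subquotients `B/(A ∩ B)` and `B'/(A' ∩ B')`
have the same number of continuous homomorphisms to any topological group `Q` (they are isomorphic
topological groups). [cite: MochizukiCombGC2007, Def 1.4(iii) p.10] -/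
theorem natCard_continuousMonoidHom_subquotient_congr [CompactSpace P] [T2Space P'] (α : P ≃ₜ* P')
    {A B : Subgroup P} {A' B' : Subgroup P'} (hA' : A.map α.toMulEquiv.toMonoidHom = A')
    (hB' : B.map α.toMulEquiv.toMonoidHom = B') (hA : IsClosed (A : Set P))
    (hB : IsClosed (B : Set P)) [(A.subgroupOf B).Normal] [(A'.subgroupOf B').Normal]
    (Q : Type*) [Group Q] [TopologicalSpace Q] :
    Nat.card {F : (B ⧸ A.subgroupOf B) →* Q // Continuous F} =
      Nat.card {F : (B' ⧸ A'.subgroupOf B') →* Q // Continuous F} := by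
  subst hA' hB'
  haveI : CompactSpace B := isCompact_iff_compactSpace.mp hB.isCompact
  -- the restricted isomorphism `B ≃* α(B)` and the induced map of quotients
  let e : B ≃* B.map (α.toMulEquiv : P →* P') := α.toMulEquiv.subgroupMap B
  have he : Continuous e := by
    apply continuous_induced_rng.mpr
    have : Subtype.val ∘ (e : B → B.map (α.toMulEquiv : P →* P')) = α ∘ Subtype.val := by
      funext x; rfl
    rw [this]
    exact α.continuous.comp continuous_subtype_val
  have hmap : (A.subgroupOf B).map (e : B →* B.map (α.toMulEquiv : P →* P')) =
      (A.map α.toMulEquiv.toMonoidHom).subgroupOf (B.map α.toMulEquiv.toMonoidHom) := by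
    ext ⟨y, hy⟩
    constructor
    · rintro ⟨x, hx, hxy⟩
      have : (α x : P') = y := congrArg Subtype.val hxy
      exact ⟨x, hx, this⟩
    · rintro ⟨a, ha, hay⟩
      obtain ⟨b, hb, hby⟩ := hy
      have hab : a = b := α.injective (hay.trans hby.symm)
      subst hab
      refine ⟨⟨a, hb⟩, ha, Subtype.ext hay⟩
  let q := QuotientGroup.congr (A.subgroupOf B)
    ((A.map α.toMulEquiv.toMonoidHom).subgroupOf (B.map α.toMulEquiv.toMonoidHom)) e hmap
  have hq : Continuous q := by
    apply (QuotientGroup.isQuotientMap_mk _).continuous_iff.mpr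
    have : (q : _ → _) ∘ QuotientGroup.mk = QuotientGroup.mk ∘ e := by funext x; rfl
    rw [this]
    exact QuotientGroup.continuous_mk.comp he
  -- the target quotient is Hausdorff (`α(A)` is closed)
  have hA'c : IsClosed (((A.map α.toMulEquiv.toMonoidHom).subgroupOf
      (B.map α.toMulEquiv.toMonoidHom) : Subgroup (B.map α.toMulEquiv.toMonoidHom)) :
        Set (B.map α.toMulEquiv.toMonoidHom)) := by
    have hAc : IsClosed ((A.map α.toMulEquiv.toMonoidHom : Subgroup P') : Set P') := by
      rw [Subgroup.coe_map]
      exact α.toHomeomorph.isClosedMap _ hA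
    exact hAc.preimage continuous_subtype_val
  haveI := hA'c
  let h := Continuous.homeoOfEquivCompactToT2 (f := q.toEquiv) hq
  exact natCard_continuousMonoidHom_congr { h with map_mul' := fun x y => q.map_mul x y } Q

/-! ### The hom-count of `M^cusp` -/

section CuspCount

variable [CompactSpace P] [TotallyDisconnectedSpace P] (G : PSCDatum P)

omit [TotallyDisconnectedSpace P] in
/-- For an open subgroup `U` of the compact group `Π_G`, `r(G_U) = 0` iff `G` is noncuspidal (each cusp
of `G` has at least one cusp of `G_U` above it; the finite-index form is the tree's
`cuspCount_eq_zero_iff`). [cite: MochizukiCombGC2007, Def 1.1(i) p.6] -/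
theorem cuspCount_eq_zero_iff_of_isOpen {U : Subgroup P} (hU : IsOpen (U : Set P)) :
    G.cuspCount U = 0 ↔ G.graph.IsNoncuspidal := by
  haveI : Finite (P ⧸ U) := Subgroup.quotient_finite_of_isOpen U hU
  haveI : U.FiniteIndex := Subgroup.finiteIndex_iff_finite_quotient.mpr inferInstance
  exact G.cuspCount_eq_zero_iff U

omit [CompactSpace P] [TotallyDisconnectedSpace P] in
/-- If `M^cusp_{G_U} = 0` (`cuspFil U = cl[U,U]`), its hom-count is `1`. [cite: MochizukiCombGC2007, Rmk 1.3.1 p.10] -/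
theorem natCard_continuousMonoidHom_cuspFil_eq_one_of_eq {U : Subgroup P}
    [((⁅U, U⁆.topologicalClosure).subgroupOf (G.cuspFil U)).Normal]
    (h : G.cuspFil U = (⁅U, U⁆).topologicalClosure) (Q : Type*) [Group Q] [TopologicalSpace Q] :
    Nat.card {F : (G.cuspFil U ⧸ (⁅U, U⁆.topologicalClosure).subgroupOf (G.cuspFil U)) →* Q //
      Continuous F} = 1 := by
  haveI : Subsingleton (G.cuspFil U ⧸ (⁅U, U⁆.topologicalClosure).subgroupOf (G.cuspFil U)) := by
    refine ⟨fun x y => ?_⟩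
    obtain ⟨a, rfl⟩ := QuotientGroup.mk_surjective x
    obtain ⟨b, rfl⟩ := QuotientGroup.mk_surjective y
    rw [QuotientGroup.eq]
    change ((a⁻¹ * b : G.cuspFil U) : P) ∈ (⁅U, U⁆).topologicalClosure
    rw [← h]
    exact (a⁻¹ * b).2
  haveI : Unique {F : (G.cuspFil U ⧸ (⁅U, U⁆.topologicalClosure).subgroupOf (G.cuspFil U)) →* Q //
      Continuous F} :=
    { default := ⟨1, continuous_const⟩
      uniq := fun F => Subtype.ext (MonoidHom.ext fun x => by
        rw [Subsingleton.elim x 1, map_one, map_one]) }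
  exact Nat.card_unique

/-- **Cusp rank in hom-count form** (Rmk. 1.3.1): if `r(G_U) > 0` then
`#Hom_cts(M^cusp_{G_U}, ℤ/l) = l^{r(G_U) − 1}`. [cite: MochizukiCombGC2007, Rmk 1.3.1 p.10] -/
theorem natCard_cuspFil_eq_pow (hc : G.CuspRank) {U : Subgroup P} (hU : IsOpen (U : Set P))
    (h0 : 0 < G.cuspCount U) [((⁅U, U⁆.topologicalClosure).subgroupOf (G.cuspFil U)).Normal]
    {l : ℕ} (hl : l.Prime) (hlS : l ∈ G.Sigma) :
    Nat.card {F : (G.cuspFil U ⧸ (⁅U, U⁆.topologicalClosure).subgroupOf (G.cuspFil U)) →*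
      Multiplicative (ZMod l) // @Continuous _ (Multiplicative (ZMod l)) _ ⊥ F} =
      l ^ (G.cuspCount U - 1) := by
  haveI : CompactSpace (G.cuspFil U) :=
    isCompact_iff_compactSpace.mp (Subgroup.isClosed_topologicalClosure _).isCompact
  have hDc : IsClosed (((⁅U, U⁆.topologicalClosure).subgroupOf (G.cuspFil U) :
      Subgroup (G.cuspFil U)) : Set (G.cuspFil U)) :=
    (Subgroup.isClosed_topologicalClosure _).preimage continuous_subtype_val
  haveI : TotallyDisconnectedSpace
      (G.cuspFil U ⧸ (⁅U, U⁆.topologicalClosure).subgroupOf (G.cuspFil U)) :=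
    AbsoluteAnabelian.QuotientGroup.totallyDisconnectedSpace_of_isClosed _ hDc
  obtain ⟨ι, hι⟩ := hc U hU h0
  exact natCard_continuousMonoidHom_zmod hι hl hlS

omit [CompactSpace P] [TotallyDisconnectedSpace P] in
/-- If `r(G_U) > 0`, a pro-`Σ` completion `ℤ^{r(G_U)−1} → M^cusp_{G_U}` with `r(G_U) − 1 = 0` has image
`{1}`, dense: `M^cusp_{G_U} = 0`. [cite: MochizukiCombGC2007, Rmk 1.3.1 p.10] -/
theorem cuspFil_eq_of_cuspCount_eq_one (hc : G.CuspRank) {U : Subgroup P} (hU : IsOpen (U : Set P))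
    (h1 : G.cuspCount U = 1) [((⁅U, U⁆.topologicalClosure).subgroupOf (G.cuspFil U)).Normal] :
    G.cuspFil U = (⁅U, U⁆).topologicalClosure := by
  have hDc : IsClosed (((⁅U, U⁆.topologicalClosure).subgroupOf (G.cuspFil U) :
      Subgroup (G.cuspFil U)) : Set (G.cuspFil U)) :=
    (Subgroup.isClosed_topologicalClosure _).preimage continuous_subtype_val
  haveI := hDc
  obtain ⟨ι, hι⟩ := hc U hU (by omega)
  apply le_antisymm _ (G.closure_commutator_le_cuspFil U)
  intro k hk
  have hdense := hι.dense
  have hrange : Set.range ι = {1} := by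
    ext y
    constructor
    · rintro ⟨v, rfl⟩
      have hv : v = 1 := by
        apply Multiplicative.toAdd.injective
        funext i
        exact Fin.elim0 (by rw [h1] at i; exact i)
      rw [hv, map_one]; rfl
    · rintro rfl; exact ⟨1, map_one ι⟩
  rw [hrange] at hdense
  have hk1 : (QuotientGroup.mk ⟨k, hk⟩ :
      G.cuspFil U ⧸ (⁅U, U⁆.topologicalClosure).subgroupOf (G.cuspFil U)) ∈
      closure ({1} : Set _) := hdense _
  rw [closure_singleton, Set.mem_singleton_iff, QuotientGroup.eq_one_iff] at hk1
  exact hk1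

omit [CompactSpace P] [TotallyDisconnectedSpace P] in
/-- If `G` is noncuspidal then `cuspFil U = cl[U,U]` (there are no cuspidal subgroups).
[cite: MochizukiCombGC2007, Rmk 1.3.1 p.10] -/
theorem cuspFil_eq_of_isNoncuspidal (hnc : G.graph.IsNoncuspidal) (U : Subgroup P) :
    G.cuspFil U = (⁅U, U⁆).topologicalClosure := by
  apply le_antisymm _ (G.closure_commutator_le_cuspFil U)
  refine Subgroup.topologicalClosure_minimal _ (sup_le (Subgroup.le_topologicalClosure _) ?_)
    (Subgroup.isClosed_topologicalClosure _)
  refine iSup_le fun A => ?_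
  obtain ⟨B, hB, -⟩ := A.2
  exact absurd hB (G.not_isCuspidal_of_isNoncuspidal hnc B)

/-- A hom-count `#Hom_cts(M^cusp_{G_U}, ℤ/l) = 1` forces `M^cusp_{G_U} = 0` (by the cusp rank, or because
`G` is noncuspidal). [cite: MochizukiCombGC2007, Rmk 1.3.1 p.10] -/
theorem cuspFil_eq_of_natCard_eq_one (hc : G.CuspRank) {U : Subgroup P} (hU : IsOpen (U : Set P))
    [((⁅U, U⁆.topologicalClosure).subgroupOf (G.cuspFil U)).Normal]
    {l : ℕ} (hl : l.Prime) (hlS : l ∈ G.Sigma)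
    (h1 : Nat.card {F : (G.cuspFil U ⧸ (⁅U, U⁆.topologicalClosure).subgroupOf (G.cuspFil U)) →*
      Multiplicative (ZMod l) // @Continuous _ (Multiplicative (ZMod l)) _ ⊥ F} = 1) :
    G.cuspFil U = (⁅U, U⁆).topologicalClosure := by
  by_cases h0 : G.cuspCount U = 0
  · exact G.cuspFil_eq_of_isNoncuspidal ((G.cuspCount_eq_zero_iff_of_isOpen hU).mp h0) U
  · have hcard := G.natCard_cuspFil_eq_pow hc hU (Nat.pos_of_ne_zero h0) hl hlS
    rw [h1] at hcard
    have hr : G.cuspCount U - 1 = 0 := by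
      by_contra hne
      have : 1 < l ^ (G.cuspCount U - 1) := Nat.one_lt_pow hne hl.one_lt
      omega
    exact G.cuspFil_eq_of_cuspCount_eq_one hc hU (by omega)

end CuspCount

/-! ### The rank recipe at one covering: `#Hom(M^edge) = #Hom(M^cusp) · #Hom(M/M^vert)` -/

section Recipe

variable [CompactSpace P] [TotallyDisconnectedSpace P] (G : PSCDatum P)

/-- **Remark 1.3.1 + Remark 1.1.4 at the covering `G_U` (sturdy `G`)**, in hom-count form: with
`D = cl[U,U]`, `#Hom_cts(edgeFil U / D, ℤ/l) = #Hom_cts(cuspFil U / D, ℤ/l) · #Hom_cts(U / vertFil U, ℤ/l)`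
(duality: rank `M^edge/M^cusp` = rank `M/M^vert`; additivity along `M^cusp ⊆ M^edge`).
[cite: MochizukiCombGC2007, Rmk 1.3.1 p.10] -/
theorem natCard_edgeFil_eq_mul (hG : G.IsSturdy) (hd : G.DualityRankEq) {U : Subgroup P}
    (hU : IsOpen (U : Set P)) [((G.vertFil U).subgroupOf U).Normal]
    [((G.cuspFil U).subgroupOf (G.edgeFil U)).Normal]
    [((⁅U, U⁆.topologicalClosure).subgroupOf (G.edgeFil U)).Normal]
    [((⁅U, U⁆.topologicalClosure).subgroupOf (G.cuspFil U)).Normal]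
    {l : ℕ} (hl : l.Prime) (hlS : l ∈ G.Sigma) :
    Nat.card {F : (G.edgeFil U ⧸ (⁅U, U⁆.topologicalClosure).subgroupOf (G.edgeFil U)) →*
        Multiplicative (ZMod l) // @Continuous _ (Multiplicative (ZMod l)) _ ⊥ F} =
      Nat.card {F : (G.cuspFil U ⧸ (⁅U, U⁆.topologicalClosure).subgroupOf (G.cuspFil U)) →*
        Multiplicative (ZMod l) // @Continuous _ (Multiplicative (ZMod l)) _ ⊥ F} *
      Nat.card {F : (U ⧸ (G.vertFil U).subgroupOf U) →* Multiplicative (ZMod l) //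
        @Continuous _ (Multiplicative (ZMod l)) _ ⊥ F} := by
  letI : TopologicalSpace (Multiplicative (ZMod l)) := ⊥
  have hUc : IsClosed (U : Set P) := Subgroup.isClosed_of_isOpen U hU
  obtain ⟨r, ι₁, ι₂, hι₁, hι₂⟩ := hd hG U hU
  -- `#Hom(U/vertFil U) = l^r`
  haveI : CompactSpace U := isCompact_iff_compactSpace.mp hUc.isCompact
  have hVc : IsClosed (((G.vertFil U).subgroupOf U : Subgroup U) : Set U) :=
    (Subgroup.isClosed_topologicalClosure _).preimage continuous_subtype_val
  haveI := hVc
  haveI : TotallyDisconnectedSpace (U ⧸ (G.vertFil U).subgroupOf U) :=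
    AbsoluteAnabelian.QuotientGroup.totallyDisconnectedSpace_of_isClosed _ hVc
  rw [natCard_continuousMonoidHom_zmod hι₁ hl hlS]
  -- additivity along `cl[U,U] ≤ cuspFil U ≤ edgeFil U`, quotient a completion of `ℤ^r`
  exact natCard_continuousMonoidHom_subquotient_eq_mul
    (fun M _ hM => G.isSigmaInteger_index_of_isOpen M hM)
    (G.closure_commutator_le_cuspFil U) (G.cuspFil_le_edgeFil U)
    (Subgroup.isClosed_topologicalClosure _) (Subgroup.isClosed_topologicalClosure _)
    (Subgroup.isClosed_topologicalClosure _) (G.commutator_edgeFil_le hUc) hι₂ hl hlS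

end Recipe

/-! ### The kernel: `M^cusp` hom-counts agree for `G_U` and `H_{α U}`; hence `r(G_U) = r(H_{α U})` -/

section Kernel

variable [CompactSpace P] [TotallyDisconnectedSpace P] [CompactSpace P'] [TotallyDisconnectedSpace P']
variable {G : PSCDatum P} {H : PSCDatum P'} {α : P ≃ₜ* P'}

/-- **Invariance of `#Hom(M^cusp, ℤ/l)` under a graphically filtration-preserving `α`** (sturdy `G`,
`H`): for every open `U ≤ Π_G`,
`#Hom_cts(M^cusp_{G_U}, ℤ/l) = #Hom_cts(M^cusp_{H_{α U}}, ℤ/l)`. [cite: MochizukiCombGC2007, Thm 1.6(ii) p.14] -/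
theorem natCard_cuspFil_eq_of_isGraphicallyFiltrationPreserving {l : ℕ} (hl : l.Prime)
    (hlG : l ∈ G.Sigma) (hlH : l ∈ H.Sigma) (hG : G.IsSturdy) (hH : H.IsSturdy)
    (hdG : G.DualityRankEq) (hdH : H.DualityRankEq) (hα : G.IsGraphicallyFiltrationPreserving H α)
    {U : Subgroup P} (hU : IsOpen (U : Set P))
    [((⁅U, U⁆.topologicalClosure).subgroupOf (G.cuspFil U)).Normal]
    [((⁅U.map α.toMulEquiv.toMonoidHom, U.map α.toMulEquiv.toMonoidHom⁆.topologicalClosure).subgroupOf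
      (H.cuspFil (U.map α.toMulEquiv.toMonoidHom))).Normal] :
    Nat.card {F : (G.cuspFil U ⧸ (⁅U, U⁆.topologicalClosure).subgroupOf (G.cuspFil U)) →*
        Multiplicative (ZMod l) // @Continuous _ (Multiplicative (ZMod l)) _ ⊥ F} =
      Nat.card {F : (H.cuspFil (U.map α.toMulEquiv.toMonoidHom) ⧸
        (⁅U.map α.toMulEquiv.toMonoidHom, U.map α.toMulEquiv.toMonoidHom⁆.topologicalClosure).subgroupOf
          (H.cuspFil (U.map α.toMulEquiv.toMonoidHom))) →*
        Multiplicative (ZMod l) // @Continuous _ (Multiplicative (ZMod l)) _ ⊥ F} := by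
  letI : TopologicalSpace (Multiplicative (ZMod l)) := ⊥
  set U' : Subgroup P' := U.map α.toMulEquiv.toMonoidHom with hU'
  have hUc : IsClosed (U : Set P) := Subgroup.isClosed_of_isOpen U hU
  have hU'o : IsOpen (U' : Set P') := by
    rw [hU', Subgroup.coe_map]
    exact α.toHomeomorph.isOpenMap _ hU
  have hU'c : IsClosed (U' : Set P') := Subgroup.isClosed_of_isOpen U' hU'o
  -- normality instances for the filtration subquotients on both sides
  haveI : ((G.vertFil U).subgroupOf U).Normal :=
    normal_subgroupOf_of_commutator_le (G.commutator_le_vertFil U)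
  haveI : ((G.cuspFil U).subgroupOf (G.edgeFil U)).Normal :=
    normal_subgroupOf_of_commutator_le
      ((G.commutator_edgeFil_le hUc).trans (G.closure_commutator_le_cuspFil U))
  haveI : ((⁅U, U⁆.topologicalClosure).subgroupOf (G.edgeFil U)).Normal :=
    normal_subgroupOf_of_commutator_le (G.commutator_edgeFil_le hUc)
  haveI : ((H.vertFil U').subgroupOf U').Normal :=
    normal_subgroupOf_of_commutator_le (H.commutator_le_vertFil U')
  haveI : ((H.cuspFil U').subgroupOf (H.edgeFil U')).Normal :=
    normal_subgroupOf_of_commutator_le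
      ((H.commutator_edgeFil_le hU'c).trans (H.closure_commutator_le_cuspFil U'))
  haveI : ((⁅U', U'⁆.topologicalClosure).subgroupOf (H.edgeFil U')).Normal :=
    normal_subgroupOf_of_commutator_le (H.commutator_edgeFil_le hU'c)
  -- the recipe on both sides
  have eG := G.natCard_edgeFil_eq_mul hG hdG hU hl hlG
  have eH := H.natCard_edgeFil_eq_mul hH hdH hU'o hl hlH
  -- transport of `M^edge` and `M/M^vert` along `α`
  have tE := natCard_continuousMonoidHom_subquotient_congr α (map_closure_commutator α U)
    (hα.2 U hU) (Subgroup.isClosed_topologicalClosure _) (Subgroup.isClosed_topologicalClosure _)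
    (Multiplicative (ZMod l))
  have tV := natCard_continuousMonoidHom_subquotient_congr α (hα.1 U hU) rfl
    (Subgroup.isClosed_topologicalClosure _) hUc (Multiplicative (ZMod l))
  rw [tE, tV, eH] at eG
  -- cancel the factor `#Hom(M/M^vert) = l^{r'} > 0`
  obtain ⟨r', ι₁', -, hι₁', -⟩ := hdH hH U' hU'o
  haveI : CompactSpace U' := isCompact_iff_compactSpace.mp hU'c.isCompact
  have hVc' : IsClosed (((H.vertFil U').subgroupOf U' : Subgroup U') : Set U') :=
    (Subgroup.isClosed_topologicalClosure _).preimage continuous_subtype_val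
  haveI := hVc'
  haveI : TotallyDisconnectedSpace (U' ⧸ (H.vertFil U').subgroupOf U') :=
    AbsoluteAnabelian.QuotientGroup.totallyDisconnectedSpace_of_isClosed _ hVc'
  have hpos : 0 < Nat.card {F : (U' ⧸ (H.vertFil U').subgroupOf U') →* Multiplicative (ZMod l) //
      Continuous F} := by
    rw [natCard_continuousMonoidHom_zmod hι₁' hl hlH]
    exact pow_pos hl.pos _
  exact (Nat.eq_of_mul_eq_mul_right hpos eG).symm

/-- **[CombGC] Theorem 1.6 (ii), the step "graphically filtration-preserving ⟹ numerically cuspidal"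
from the rank statements (Remark 1.3.1 / Prop. 1.3), sturdy case** — sub-DAG row T16-L08 KERNEL.
Let `Π_G`, `Π_H` be profinite, `G`, `H` sturdy, `l` a prime in `Σ_G ∩ Σ_H`; assume the Remark-1.3.1
statements `DualityRankEq`, `CuspRank`, `NoncuspidalIffCuspFilTrivial` for `G` and for `H`.  Then a
graphically filtration-preserving `α : Π_G ≅ Π_H` is numerically cuspidal: `r(G_U) = r(H_{α U})` for
every open `U`.  (If both counts are positive, `l^{r(G_U) − 1} = l^{r(H_{αU}) − 1}` by the cusp rank; if
`r(G_U) = 0` then `G` is noncuspidal, all `M^cusp_{G_V}` vanish, hence all `M^cusp_{H_{V'}}` have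
hom-count `1`, hence vanish, hence `H` is noncuspidal — and symmetrically.)
[cite: MochizukiCombGC2007, Thm 1.6(ii) p.14] -/
theorem isNumericallyCuspidal_of_isGraphicallyFiltrationPreserving_of_rankStatements {l : ℕ}
    (hl : l.Prime) (hlG : l ∈ G.Sigma) (hlH : l ∈ H.Sigma) (hG : G.IsSturdy) (hH : H.IsSturdy)
    (hdG : G.DualityRankEq) (hcG : G.CuspRank) (hnG : G.NoncuspidalIffCuspFilTrivial)
    (hdH : H.DualityRankEq) (hcH : H.CuspRank) (hnH : H.NoncuspidalIffCuspFilTrivial)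
    (hα : G.IsGraphicallyFiltrationPreserving H α) : G.IsNumericallyCuspidal H α := by
  letI : TopologicalSpace (Multiplicative (ZMod l)) := ⊥
  -- normality instances for closed `V` (both sides); images and preimages of open subgroups
  have nG : ∀ {V : Subgroup P}, IsClosed (V : Set P) →
      ((⁅V, V⁆.topologicalClosure).subgroupOf (G.cuspFil V)).Normal := fun hV =>
    normal_subgroupOf_of_commutator_le
      ((Subgroup.commutator_mono (G.cuspFil_le hV) (G.cuspFil_le hV)).trans
        (Subgroup.le_topologicalClosure _))
  have nH : ∀ {V' : Subgroup P'}, IsClosed (V' : Set P') →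
      ((⁅V', V'⁆.topologicalClosure).subgroupOf (H.cuspFil V')).Normal := fun hV' =>
    normal_subgroupOf_of_commutator_le
      ((Subgroup.commutator_mono (H.cuspFil_le hV') (H.cuspFil_le hV')).trans
        (Subgroup.le_topologicalClosure _))
  have himg : ∀ {V : Subgroup P}, IsOpen (V : Set P) →
      IsOpen ((V.map α.toMulEquiv.toMonoidHom : Subgroup P') : Set P') := fun {V} hV => by
    rw [Subgroup.coe_map]
    exact α.toHomeomorph.isOpenMap _ hV
  -- `G` noncuspidal ⟹ `H` noncuspidal, and conversely
  have ncH_of_ncG : G.graph.IsNoncuspidal → H.graph.IsNoncuspidal := fun hncG => by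
    apply hnH.mpr
    intro V' hV'
    set V : Subgroup P := V'.comap α.toMulEquiv.toMonoidHom with hVdef
    have hV : IsOpen (V : Set P) := hV'.preimage α.continuous
    have hVmap : V.map α.toMulEquiv.toMonoidHom = V' :=
      Subgroup.map_comap_eq_self_of_surjective α.surjective _
    haveI := nG (Subgroup.isClosed_of_isOpen V hV)
    haveI := nH (Subgroup.isClosed_of_isOpen _ (himg hV))
    have h1 := natCard_cuspFil_eq_of_isGraphicallyFiltrationPreserving hl hlG hlH hG hH hdG hdH hα hV
    rw [G.natCard_continuousMonoidHom_cuspFil_eq_one_of_eq (hnG.mp hncG V hV)] at h1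
    have := H.cuspFil_eq_of_natCard_eq_one hcH (himg hV) hl hlH h1.symm
    rwa [hVmap] at this
  have ncG_of_ncH : H.graph.IsNoncuspidal → G.graph.IsNoncuspidal := fun hncH => by
    apply hnG.mpr
    intro V hV
    haveI := nG (Subgroup.isClosed_of_isOpen V hV)
    haveI := nH (Subgroup.isClosed_of_isOpen _ (himg hV))
    have h1 := natCard_cuspFil_eq_of_isGraphicallyFiltrationPreserving hl hlG hlH hG hH hdG hdH hα hV
    rw [H.natCard_continuousMonoidHom_cuspFil_eq_one_of_eq (hnH.mp hncH _ (himg hV))] at h1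
    exact G.cuspFil_eq_of_natCard_eq_one hcG hV hl hlG h1
  -- the count at `U`
  intro U hU
  have hU'o := himg hU
  by_cases hcG0 : G.cuspCount U = 0
  · rw [hcG0, eq_comm, H.cuspCount_eq_zero_iff_of_isOpen hU'o]
    exact ncH_of_ncG ((G.cuspCount_eq_zero_iff_of_isOpen hU).mp hcG0)
  by_cases hcH0 : H.cuspCount (U.map α.toMulEquiv.toMonoidHom) = 0
  · exact absurd ((G.cuspCount_eq_zero_iff_of_isOpen hU).mpr
      (ncG_of_ncH ((H.cuspCount_eq_zero_iff_of_isOpen hU'o).mp hcH0))) hcG0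
  -- both counts positive: compare cusp ranks
  haveI := nG (Subgroup.isClosed_of_isOpen U hU)
  haveI := nH (Subgroup.isClosed_of_isOpen _ hU'o)
  have h := natCard_cuspFil_eq_of_isGraphicallyFiltrationPreserving hl hlG hlH hG hH hdG hdH hα hU
  rw [G.natCard_cuspFil_eq_pow hcG hU (Nat.pos_of_ne_zero hcG0) hl hlG,
    H.natCard_cuspFil_eq_pow hcH hU'o (Nat.pos_of_ne_zero hcH0) hl hlH] at h
  have := Nat.pow_right_injective hl.two_le h
  omega

end Kernel

/-! ### The printed form over the origin parameter (appended, abc-iut-w5-d183) -/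

section Origin

variable (Ω : PSCOrigin.{u})

/-- **[CombGC] Theorem 1.6 (ii), the "numerically cuspidal" step, as printed over the origin `Ω`**:
granting the Remark-1.3.1 rank statements for all data of `Ω`-type (`RankStatementsHold Ω`, sub-node
statements) and profiniteness of their PSC-fundamental groups (Def. 1.1 (ii), displayed inline
hypothesis), for all STURDY `G`, `H` of `Ω`-type with the same `Σ` and every graphically
filtration-preserving `α : Π_G ≅ Π_H`, `α` is numerically cuspidal.
[cite: MochizukiCombGC2007, Thm 1.6(ii) p.14] -/
theorem isNumericallyCuspidal_of_isGraphicallyFiltrationPreserving_holds (hrank : RankStatementsHold Ω)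
    (hprof : ∀ ⦃Q : Type u⦄ [Group Q] [TopologicalSpace Q] [IsTopologicalGroup Q] (G : PSCDatum Q),
      Ω.IsOfPSCType G → CompactSpace Q ∧ TotallyDisconnectedSpace Q)
    ⦃Q : Type u⦄ [Group Q] [TopologicalSpace Q] [IsTopologicalGroup Q]
    ⦃Q' : Type u⦄ [Group Q'] [TopologicalSpace Q'] [IsTopologicalGroup Q']
    {G : PSCDatum Q} {H : PSCDatum Q'} {α : Q ≃ₜ* Q'} (hGΩ : Ω.IsOfPSCType G) (hHΩ : Ω.IsOfPSCType H)
    (hS : G.Sigma = H.Sigma) (hG : G.IsSturdy) (hH : H.IsSturdy)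
    (hα : G.IsGraphicallyFiltrationPreserving H α) : G.IsNumericallyCuspidal H α := by
  obtain ⟨hcQ, htQ⟩ := hprof G hGΩ
  obtain ⟨hcQ', htQ'⟩ := hprof H hHΩ
  obtain ⟨-, hdG, hcG, hnG⟩ := hrank G hGΩ
  obtain ⟨-, hdH, hcH, hnH⟩ := hrank H hHΩ
  obtain ⟨l, hlG⟩ := G.sigma_nonempty
  have hl : l.Prime := G.sigma_prime l hlG
  have hlH : l ∈ H.Sigma := hS ▸ hlG
  exact isNumericallyCuspidal_of_isGraphicallyFiltrationPreserving_of_rankStatements hl hlG hlH hG hH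
    hdG hcG hnG hdH hcH hnH hα

end Origin

end PSCDatum

end Literature.AnabelianGeometry.SemiGraphs
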